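import Mathlib
import Literature.NumberTheory.EllipticCurves.EichlerShimuraConstruction
import Literature.NumberTheory.EllipticCurves.NewformsLevelEqOfHeckeEigenvalueEqProofs
import Literature.NumberTheory.EllipticCurves.PAdicLFunctionDistributionProofs
import Literature.NumberTheory.EllipticCurves.LFunctionPrimeCoeff
import Literature.NumberTheory.EllipticCurves.ModularityVersionApProofs
import Literature.NumberTheory.EllipticCurves.GaloisAction
import Literature.NumberTheory.EllipticCurves.GlobalMinimalModel
import HarnessLib

/-!
# DeepCongruenceFiniteness

Topic `Literature/NumberTheory/EllipticCurves`. Named literature fact(s) relocated by the gate from `Summits/BirchSwinnertonDyer/BirchSwinnertonDyer/Theorems/ShadowIsolationIsolationOfAccidentalZerosStubRationalSectorFinite.lean`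
(accept-time relocation of `[cite]`d propositions written inline in a Summits proposal; human ruling 2026-08-15).
Sources: CremonaFreitas2021, Faltings1983Endlichkeit, Mazur1989Deforming.

* `Literature.NumberTheory.EllipticCurves.DeepCongruenceFinite`
-/

namespace Literature.NumberTheory.EllipticCurves

open scoped MatrixGroups ModularForm
open CongruenceSubgroup UpperHalfPlane
open Literature.NumberTheory.EllipticCurves Literature.NumberTheory.EllipticCurves.ModularForms

/-- **Finiteness of deep congruences to a fixed elliptic curve** (Mordell–Faltings on the twisted modular
curves `X_E^α(pⁿ)`, with Carayol's theorem on representations with equal traces). Let `E/ℚ` be an elliptic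
curve (any Weierstrass model `W`), `p` an odd prime such that `E[p]` is an irreducible Galois module, and
`n` with `pⁿ ≥ 7`. Then the set of `L`-coefficient sequences `(aₘ(E'))ₘ` (Mathlib's
`WeierstrassCurve.LFunction`, an isogeny invariant computed on minimal models) of elliptic curves `E'/ℚ`
such that `aℓ(E') ≡ aℓ(E) (mod pⁿ)` for all but finitely many primes `ℓ` is FINITE.
Provenance (assembled; the printed statements): (1) for all but finitely many `ℓ` the two sides are the
traces of `Frob_ℓ` on `E'[pⁿ]`, `E[pⁿ]`, so by Chebotarev the `G_ℚ`-representations on `E'[pⁿ] ≅ (ℤ/pⁿ)²`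
and `E[pⁿ]` have equal traces, and `E[p]` is absolutely irreducible (`p` odd, complex conjugation has
eigenvalues `±1`), hence `E'[pⁿ] ≅ E[pⁿ]` as Galois modules — Carayol 1994, Thm. 1 (= Mazur 1989, §1.8
Prop. (Carayol); at `n = 1` Kraus–Oesterlé 1992, Prop. 4 / Brauer–Nesbitt); (2) such `E'` together with
the isomorphism is a non-cuspidal `ℚ`-point of one of the finitely many twists `X_E^α(pⁿ)`,
`α ∈ (ℤ/pⁿ)ˣ`, of the modular curve `X(pⁿ)`, which has genus `> 1` for `pⁿ ≥ 7` (Fisher 2014, §1: "for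
`n ≥ 7` the genus of `X_E(n)` is greater than `1`", genus formula §2; Cremona–Freitas 2022, §1.1: "for
primes `p ≥ 7` the curve `X_E(p)` has genus `≥ 3` and so for each `E` there are only finitely many mod `p`
congruences with `E`"; Fisher 2014, Rem. 5.2 for the newform phrasing), so by Faltings 1983, Satz 7
(Mordell) there are finitely many `ℚ`-isomorphism classes of such `E'`, and `(aₘ(E'))ₘ` depends only on
the class. [cite: Faltings1983Endlichkeit, Satz 7] [cite: Mazur1989Deforming, §1.8 Prop. (Carayol)]
[cite: CremonaFreitas2021, §1.1] [file NumberTheory/EllipticCurves/DeepCongruenceFiniteness] -/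
def DeepCongruenceFinite : Prop :=
  ∀ (W : WeierstrassCurve ℚ) [W.IsElliptic] (p n : ℕ) [Fact p.Prime], p ≠ 2 →
    W.HasIrreducibleModPGaloisRep p → 7 ≤ p ^ n →
    Set.Finite {a : ℕ → ℤ | ∃ (W' : WeierstrassCurve ℚ) (_ : W'.IsElliptic),
      (∀ m : ℕ, a m = W'.LFunction m) ∧
      {ℓ : ℕ | ℓ.Prime ∧ ¬ ((p : ℤ) ^ n ∣ W'.LFunction ℓ - W.LFunction ℓ)}.Finite}

/-! ## Injectivity of `(M, g) ↦ (aₘ(g))ₘ` on newforms of level `N·M` -/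

end Literature.NumberTheory.EllipticCurves
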